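import Literature.NumberTheory.Sieve.HeathBrownCubicTypeIILocalise
import Literature.NumberTheory.Sieve.HeathBrownCubicTypeIITail
import Literature.NumberTheory.Sieve.HeathBrownCubicTypeIIWeights
import Literature.NumberTheory.Sieve.HeathBrownCubicTypeIISmallQ
import HarnessLib

/-!
# Heath-Brown's Lemma 3.10, §§12–13: the Class I cells — Möbius in `d`, main part and tail

Support for the proof of **Lemma 3.10** of D. R. Heath-Brown, *Primes represented by `x³ + 2y³`*,
Acta Math. 186 (2001), §12 p. 75 and §13 p. 78:

> "We proceed to pick out the condition h.c.f.(v₁, v₂, v₃) = D by using the Möbius function. Large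
> values of `dD` will make a negligible contribution. … `S₆ ≪ S₈ + VXY⁻¹⁵(log X)^c`, where
> `S₈ = ∑_{D ∈ I_m} ∑_d μ(d) ∑_{β̂ᵢ ∈ Cᵢ, Dd ∣ v} F'_{β₁}F'_{β₂}` with `d` restricted by `dD ≤ d₀`" (p. 77);
> "`|S₈| ≤ ∑_{D,d} (Dd)⁻² ∑_{a (mod dD)} |S((dD)⁻¹a; C)|²` … `S₈ ≪ XV⁻¹ log V ∑_{q ≤ d₀} (τ(q)/q) ∑* |S(q⁻¹b)|²`" (p. 78).

For a pair of hypercubes `(C(𝐧), C(𝐧'))` we sum `S₆(t, 𝐧, 𝐧')` over the cells `t` for which the pair is of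
Class I, insert `[h.c.f.(v) = D] = ∑_d μ(d)[dD ∣ v]`, split at `dD ≤ d₀`, and PROVE:

* `classISum`, `goodCube`, the Möbius identities `moebius_hcf_indicator`, `indicator_cond_eq_sum`;
* `abs_classISum_le`: `|∑_{t Class I} S₆| ≤ ½ ∑_{q ≤ d₀} w(q)(U*₁(q) + U*₂(q)) + 81·tailPair` (characters +
  Cauchy from `HeathBrownCubicTypeIICharSum`, reduction and weights from `HeathBrownCubicTypeIIWeights`);
* **`sum_abs_classISum_le`**: summed over all pairs of `Nrange`,
  `∑ |∑_{t Class I} S₆| ≤ #Nrange · ∑_{𝐧 good} ∑_{q ≤ d₀} w(q) U*(C(𝐧), q) + 81·TL(T, d₀)` (the tail pairs of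
  all good hypercube pairs inject into `TLset`, `HeathBrownCubicTypeIITail`).

## References

* D. R. Heath-Brown, *Primes represented by `x³ + 2y³`*, Acta Math. 186 (2001), §12 pp. 75–77, §13 p. 78.
  [cite: HeathBrownActa2001, §§12–13 pp. 75–78]

## Mathlib / tree search

Tree: `HeathBrownCubicTypeIILocalise` (`S6`, `LC`, `ClassI`, `GoodB`, `tIdx`, `Trange`, `Nrange`),
`HeathBrownCubicTypeIITail` (`TL`, `TLset`, `Gset`, `tauK`), `HeathBrownCubicTypeIIWeights` (`wt`, `Ustar`,
`sum_pairs_Tsum_le`), `HeathBrownCubicTypeIICharSum` (`abs_sum_dvd_cross3_le`), `HeathBrownCubicTypeIISmallQ`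
(`Fprim`), `SieveFrameworkProofs` (`sum_divisors_moebius_real`).
-/

noncomputable section

open Finset NumberField ArithmeticFunction

open scoped ArithmeticFunction.Moebius ArithmeticFunction.sigma

namespace Literature.NumberTheory.Sieve.CubicSieve

open LFunctions.CubeRootTwoField CubicPrimes LargeSieve

/-! ### Möbius identities -/

open scoped Classical in
/-- `[h.c.f.(v) = D] = ∑_{d ≤ H} μ(d) [dD ∣ v]` for `v ≠ 0`, `D ≥ 1`, `h.c.f.(v) ≤ H`. [cite: HeathBrownActa2001, §12 p. 75] -/
theorem moebius_hcf_indicator {v : ℤ × ℤ × ℤ} (hv : v ≠ 0) {D : ℕ} (hD : 1 ≤ D) {H : ℕ} (hH : hcf3 v ≤ H) :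
    (if hcf3 v = D then (1 : ℝ) else 0) =
      ∑ d ∈ Icc 1 H, (μ d : ℝ) * (if DvdVec ((d * D : ℕ) : ℤ) v then 1 else 0) := by
  classical
  have h0 : 1 ≤ hcf3 v := one_le_hcf3 hv
  by_cases hDv : D ∣ hcf3 v
  · obtain ⟨h', hh'⟩ := hDv
    have hh'0 : h' ≠ 0 := by intro h0'; rw [h0', mul_zero] at hh'; omega
    -- `dD ∣ v ↔ d ∣ h'`
    have hequiv : ∀ d : ℕ, DvdVec ((d * D : ℕ) : ℤ) v ↔ d ∣ h' := by
      intro d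
      rw [← natCast_dvd_hcf3_iff, hh', mul_comm d D]
      exact Nat.mul_dvd_mul_iff_left (by omega)
    have hdivs : h'.divisors = (Icc 1 H).filter (fun d => d ∣ h') := by
      ext d
      rw [Nat.mem_divisors, mem_filter, mem_Icc]
      constructor
      · rintro ⟨hd, -⟩
        refine ⟨⟨Nat.pos_of_dvd_of_pos hd (Nat.pos_of_ne_zero hh'0), ?_⟩, hd⟩
        calc d ≤ h' := Nat.le_of_dvd (Nat.pos_of_ne_zero hh'0) hd
          _ ≤ D * h' := Nat.le_mul_of_pos_left _ (by omega)
          _ = hcf3 v := hh'.symm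
          _ ≤ H := hH
      · rintro ⟨-, hd⟩; exact ⟨hd, hh'0⟩
    calc (if hcf3 v = D then (1 : ℝ) else 0) = if h' = 1 then 1 else 0 := by
          by_cases h1 : h' = 1
          · rw [if_pos h1, if_pos (by rw [hh', h1, mul_one])]
          · rw [if_neg h1, if_neg]
            intro hc; rw [hc] at hh'
            exact h1 (by nlinarith)
      _ = ∑ d ∈ h'.divisors, (μ d : ℝ) := (Literature.NumberTheory.Sieve.sum_divisors_moebius_real h').symm
      _ = ∑ d ∈ Icc 1 H, if d ∣ h' then (μ d : ℝ) else 0 := by rw [hdivs, sum_filter]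
      _ = _ := by
          refine sum_congr rfl fun d _ => ?_
          rw [hequiv d]
          split_ifs <;> simp
  · rw [if_neg (fun h : hcf3 v = D => hDv (by rw [h]))]
    symm
    refine sum_eq_zero fun d _ => ?_
    rw [if_neg, mul_zero]
    intro hdv
    apply hDv
    have : d * D ∣ hcf3 v := (natCast_dvd_hcf3_iff _ _).mpr hdv
    exact (Nat.dvd_mul_left D d).trans this

open scoped Classical in
/-- Splitting an indicator over the value of `h.c.f.(v)`: `[P(h)] = ∑_{D ≤ H, P(D)} [h = D]` (`1 ≤ h ≤ H`).
[folklore] -/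
theorem indicator_cond_eq_sum {h H : ℕ} (h1 : 1 ≤ h) (hH : h ≤ H) (P : ℕ → Prop) [DecidablePred P] :
    (if P h then (1 : ℝ) else 0) = ∑ D ∈ (Icc 1 H).filter (fun D => P D), if h = D then (1 : ℝ) else 0 := by
  classical
  by_cases hP : P h
  · rw [if_pos hP, sum_ite_eq]
    rw [if_pos]; rw [mem_filter, mem_Icc]; exact ⟨⟨h1, hH⟩, hP⟩
  · rw [if_neg hP, sum_ite_eq, if_neg]
    rw [mem_filter]; exact fun hc => hP hc.2

/-! ### The Class I sum of a pair of hypercubes -/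

section Defs

variable (X η τ : ℝ) {k : ℕ} (m : Fin k → ℕ) (V T : ℝ) (N : ℕ) (Δ₀ : ℝ)

open scoped Classical in
/-- The cells `t` for which `(C(𝐧), C(𝐧'))` is of Class I. [cite: HeathBrownActa2001, Lemma 12.1] -/
def TI (n n' : ℤ × ℤ × ℤ) : Finset ℕ :=
  (Trange N Δ₀ (270 * V / X)).filter (fun t => ClassI X η T V N t n n')

open scoped Classical in
/-- **`∑_{t : Class I} S₆(t, 𝐧, 𝐧')`**. [cite: HeathBrownActa2001, Lemma 12.1] -/
def classISum (n n' : ℤ × ℤ × ℤ) : ℝ :=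
  ∑ t ∈ TI X η V T N Δ₀ n n', S6 X τ m T N Δ₀ t n n'

/-- **Good hypercube**: every real point of the closed hypercube is good (window and norm), as for the
hypercubes of a Class I cell. [cite: HeathBrownActa2001, §12 p. 72] -/
def goodCube (n : ℤ × ℤ × ℤ) : Prop := ∀ p ∈ realCell (T / N) n, GoodB T V p

open scoped Classical in
/-- The divisibility sums `Φ(e) = ∑_{β̂ᵢ ∈ Cᵢ, e ∣ β̂₁∧β̂₂} F'_{β₁}F'_{β₂}`. [cite: HeathBrownActa2001, §12 p. 77] -/
def PhiSum (n n' : ℤ × ℤ × ℤ) (e : ℕ) : ℝ :=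
  ∑ b₁ ∈ LC (T / N) n, ∑ b₂ ∈ LC (T / N) n',
    (if DvdVec (e : ℤ) (cross3 b₁ b₂) then Fprim X τ m b₁ * Fprim X τ m b₂ else 0)

open scoped Classical in
/-- The tail pairs of `(C(𝐧), C(𝐧'))`: primitive `β̂₁, β̂₂` with `β̂₁∧β̂₂ ≠ 0`, `h.c.f. > d₀`, weighted by
`τ(β₁)τ(β₂)σ₀(h.c.f.)²`. [cite: HeathBrownActa2001, §12 p. 76] -/
def tailPair (d₀ : ℝ) (n n' : ℤ × ℤ × ℤ) : ℝ :=
  ∑ bb ∈ (LC (T / N) n ×ˢ LC (T / N) n').filter (fun bb => IsPrimitiveVec bb.1 ∧ IsPrimitiveVec bb.2 ∧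
      cross3 bb.1 bb.2 ≠ 0 ∧ d₀ < (hcf3 (cross3 bb.1 bb.2) : ℝ)),
    tauK bb.1 * tauK bb.2 * ((σ 0 (hcf3 (cross3 bb.1 bb.2)) : ℝ)) ^ 2

end Defs

variable {X η τ V T : ℝ} {k : ℕ} {m : Fin k → ℕ} {N : ℕ} {Δ₀ : ℝ}

/-- A Class I cell makes both hypercubes good, and distinct. [cite: HeathBrownActa2001, Lemma 12.1] -/
theorem goodCube_of_classI (hX : 0 < X) (hT : 0 < T) (hN : 0 < N) {t : ℕ} {n n' : ℤ × ℤ × ℤ}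
    (hI : ClassI X η T V N t n n') : goodCube V T N n ∧ goodCube V T N n' ∧ n ≠ n' := by
  have hNR : (0 : ℝ) < N := by exact_mod_cast hN
  have hs : 0 < T / N := by positivity
  refine ⟨fun p hp => ?_, fun p hp => ?_, ne_of_classI hX hT.le hI⟩
  · exact (hI _ hp _ (corner_mem_realCell hs.le n')).1
  · exact (hI _ (corner_mem_realCell hs.le n) _ hp).2.1

/-- Lattice points of a good hypercube: window, box, `|β̂|_∞ > T/4`, `β̂ ∈ Gset`, `ell > 0`, `β̂ ≠ 0`.
[cite: HeathBrownActa2001, §11 (11.5)] -/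
theorem good_point_facts (hT : 0 < T) (hTV : T ^ 3 = V) (hN : 0 < N) {n : ℤ × ℤ × ℤ} (hg : goodCube V T N n)
    {b : ℤ × ℤ × ℤ} (hb : b ∈ LC (T / N) n) :
    InWindow T (coordElt b) ∧ b ∈ Bbox T ∧ T / 4 < (supZ b : ℝ) ∧ b ∈ Gset T ∧ 0 < ell (castVec b) ∧ b ≠ 0 := by
  have hNR : (0 : ℝ) < N := by exact_mod_cast hN
  have hs : 0 < T / N := by positivity
  have hG := hg _ (castVec_mem_realCell hs hb)
  have hw : InWindow T (coordElt b) := window_of_goodB hG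
  obtain ⟨⟨h1, h2⟩, ⟨hN1, hN2⟩⟩ := hG
  obtain ⟨a1, a2, a3⟩ := abs_coord_le_of_inWindow hT hTV h1 h2 hN2
  have hB : b ∈ Bbox T := mem_cube_of_abs_le a1 a2 a3
  have hsup := supZ_gt_of_inWindow hT hw
  have hell : 0 < ell (castVec b) := lt_trans hT h1
  have hne : b ≠ 0 := by
    intro h0; rw [h0] at hsup
    have : supZ (0 : ℤ × ℤ × ℤ) = 0 := (supZ_eq_zero_iff 0).mpr rfl
    rw [this] at hsup; push_cast at hsup; linarith
  exact ⟨hw, hB, hsup, by rw [Gset, mem_filter]; exact ⟨hB, hsup⟩, hell, hne⟩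

/-- `h.c.f.(v) ≤ |v|_∞` for `v ≠ 0`. [folklore] -/
theorem hcf3_le_supZ {v : ℤ × ℤ × ℤ} (hv : v ≠ 0) : (hcf3 v : ℤ) ≤ supZ v := by
  obtain ⟨i, hi⟩ : ∃ x : ℤ, (x = v.1 ∨ x = v.2.1 ∨ x = v.2.2) ∧ x ≠ 0 := by
    by_contra hcon
    push Not at hcon
    apply hv
    refine Prod.ext (hcon _ (Or.inl rfl)) (Prod.ext (hcon _ (Or.inr (Or.inl rfl))) (hcon _ (Or.inr (Or.inr rfl))))
  obtain ⟨d1, d2, d3⟩ := hcf3_dvd v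
  have hdi : (hcf3 v : ℤ) ∣ i := by rcases hi.1 with h | h | h <;> rw [h] <;> assumption
  have hle_i : (hcf3 v : ℤ) ≤ |i| := Int.le_of_dvd (abs_pos.mpr hi.2) ((dvd_abs _ _).mpr hdi)
  have hi_le : |i| ≤ supZ v := by
    rcases hi.1 with h | h | h <;> rw [h]
    · exact abs_fst_le_supZ _
    · exact abs_snd_le_supZ _
    · exact abs_thd_le_supZ _
  exact hle_i.trans hi_le

/-- `h.c.f.(β̂₁ ∧ β̂₂) ≤ 18T² < ⌊18T²⌋₊ + 1` for `β̂ᵢ ∈ Bbox`. [folklore] -/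
theorem hcf3_cross3_le (hT : 0 < T) {b₁ b₂ : ℤ × ℤ × ℤ} (h₁ : b₁ ∈ Bbox T) (h₂ : b₂ ∈ Bbox T)
    (hv : cross3 b₁ b₂ ≠ 0) : hcf3 (cross3 b₁ b₂) ≤ ⌊18 * T ^ 2⌋₊ + 1 := by
  have hs1 := supZ_le_of_mem_cube h₁
  have hs2 := supZ_le_of_mem_cube h₂
  have hle : (hcf3 (cross3 b₁ b₂) : ℤ) ≤ supZ (cross3 b₁ b₂) := hcf3_le_supZ hv
  have h18 : (hcf3 (cross3 b₁ b₂) : ℝ) ≤ 18 * T ^ 2 := by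
    have h := supZ_cross3_le b₁ b₂
    have hR : (supZ (cross3 b₁ b₂) : ℝ) ≤ 2 * (supZ b₁ : ℝ) * (supZ b₂ : ℝ) := by exact_mod_cast h
    have h0 : (0 : ℝ) ≤ supZ b₁ := by exact_mod_cast supZ_nonneg _
    have hleR : (hcf3 (cross3 b₁ b₂) : ℝ) ≤ (supZ (cross3 b₁ b₂) : ℝ) := by exact_mod_cast hle
    nlinarith
  have := Nat.lt_floor_add_one (18 * T ^ 2)
  have : (hcf3 (cross3 b₁ b₂) : ℝ) < ((⌊18 * T ^ 2⌋₊ + 1 : ℕ) : ℝ) := by push_cast; linarith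
  exact_mod_cast this.le

/-! ### The expansion of the Class I sum -/

open scoped Classical in
/-- `∑_{t ∈ TI} S₆(t) = ∑_{(β̂₁,β̂₂) ∈ C₁×C₂} F'₁F'₂ · [Δ₀ < h.c.f., cell(h.c.f.) ∈ TI]`. [cite: HeathBrownActa2001, Lemma 12.1] -/
theorem classISum_eq_sum_pairs (n n' : ℤ × ℤ × ℤ) :
    classISum X η τ m V T N Δ₀ n n' =
      ∑ bb ∈ LC (T / N) n ×ˢ LC (T / N) n', Fprim X τ m bb.1 * Fprim X τ m bb.2 *
        (if Δ₀ < (hcf3 (cross3 bb.1 bb.2) : ℝ) ∧ tIdx N (hcf3 (cross3 bb.1 bb.2)) ∈ TI X η V T N Δ₀ n n'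
          then 1 else 0) := by
  classical
  rw [classISum]
  simp only [S6]
  set F := (LC (T / N) n ×ˢ LC (T / N) n').filter (fun bb => IsPrimitiveVec bb.1 ∧ IsPrimitiveVec bb.2 ∧
      Δ₀ < (Dhcf bb : ℝ) ∧ tIdx N (Dhcf bb) ∈ TI X η V T N Δ₀ n n') with hF
  have hfib : ∀ t ∈ TI X η V T N Δ₀ n n',
      (LC (T / N) n ×ˢ LC (T / N) n').filter (fun bb => IsPrimitiveVec bb.1 ∧ IsPrimitiveVec bb.2 ∧
        Δ₀ < (Dhcf bb : ℝ) ∧ tIdx N (Dhcf bb) = t) = F.filter (fun bb => tIdx N (Dhcf bb) = t) := by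
    intro t ht
    rw [hF, filter_filter]
    refine filter_congr fun bb _ => ?_
    constructor
    · rintro ⟨h1, h2, h3, h4⟩; exact ⟨⟨h1, h2, h3, by rw [h4]; exact ht⟩, h4⟩
    · rintro ⟨⟨h1, h2, h3, -⟩, h4⟩; exact ⟨h1, h2, h3, h4⟩
  rw [sum_congr rfl fun t ht => by rw [hfib t ht]]
  rw [sum_fiberwise_of_maps_to (g := fun bb => tIdx N (Dhcf bb)) (fun bb hbb => by
    rw [hF, mem_filter] at hbb; exact hbb.2.2.2.2)]
  rw [hF, sum_filter]
  refine sum_congr rfl fun bb _ => ?_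
  simp only [Dhcf, Fprim]
  by_cases hp1 : IsPrimitiveVec bb.1
  · by_cases hp2 : IsPrimitiveVec bb.2
    · simp only [hp1, hp2, true_and, if_true]
      split_ifs <;> ring
    · simp [hp1, hp2]
  · simp [hp1]

open scoped Classical in
/-- **Möbius expansion of the Class I sum** (good, distinct hypercubes):
`∑_{t ∈ TI} S₆(t) = ∑_{D ∈ 𝒟} ∑_{d ≤ H} μ(d) Φ(dD)`, `𝒟 = {D ≤ H : Δ₀ < D, cell(D) ∈ TI}`, `H = ⌊18T²⌋₊ + 1`.
[cite: HeathBrownActa2001, §12 p. 75] -/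
theorem classISum_eq_moebius (hT : 0 < T) (hTV : T ^ 3 = V) {n n' : ℤ × ℤ × ℤ}
    (hg : goodCube V T N n) (hg' : goodCube V T N n') (hnn : n ≠ n') (hN : 0 < N) :
    classISum X η τ m V T N Δ₀ n n' =
      ∑ D ∈ (Icc 1 (⌊18 * T ^ 2⌋₊ + 1)).filter (fun D : ℕ => Δ₀ < (D : ℝ) ∧ tIdx N D ∈ TI X η V T N Δ₀ n n'),
        ∑ d ∈ Icc 1 (⌊18 * T ^ 2⌋₊ + 1), (μ d : ℝ) * PhiSum X τ m T N n n' (d * D) := by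
  classical
  have hNR : (0 : ℝ) < N := by exact_mod_cast hN
  have hs : 0 < T / N := by positivity
  set H : ℕ := ⌊18 * T ^ 2⌋₊ + 1 with hH
  set 𝒟 := (Icc 1 H).filter (fun D : ℕ => Δ₀ < (D : ℝ) ∧ tIdx N D ∈ TI X η V T N Δ₀ n n') with h𝒟
  rw [classISum_eq_sum_pairs]
  -- pointwise identity
  have hpt : ∀ bb ∈ LC (T / N) n ×ˢ LC (T / N) n',
      Fprim X τ m bb.1 * Fprim X τ m bb.2 *
        (if Δ₀ < (hcf3 (cross3 bb.1 bb.2) : ℝ) ∧ tIdx N (hcf3 (cross3 bb.1 bb.2)) ∈ TI X η V T N Δ₀ n n' then 1 else 0) =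
      ∑ D ∈ 𝒟, ∑ d ∈ Icc 1 H, (μ d : ℝ) *
        (if DvdVec ((d * D : ℕ) : ℤ) (cross3 bb.1 bb.2) then Fprim X τ m bb.1 * Fprim X τ m bb.2 else 0) := by
    intro bb hbb
    by_cases hz : Fprim X τ m bb.1 * Fprim X τ m bb.2 = 0
    · rw [hz, zero_mul]
      symm; refine sum_eq_zero fun D _ => sum_eq_zero fun d _ => ?_
      simp
    · have hp1 : IsPrimitiveVec bb.1 := by
        by_contra h; apply hz; rw [Fprim, if_neg h, zero_mul]
      have hp2 : IsPrimitiveVec bb.2 := by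
        by_contra h; apply hz; rw [mul_comm, Fprim, if_neg h, zero_mul]
      rw [mem_product] at hbb
      obtain ⟨-, hB1, -, -, hell1, -⟩ := good_point_facts hT hTV hN hg hbb.1
      obtain ⟨-, hB2, -, -, hell2, -⟩ := good_point_facts hT hTV hN hg' hbb.2
      have hne : bb.1 ≠ bb.2 := by
        intro h
        have h1 := (mem_LC_iff hs).mp hbb.1
        have h2 := (mem_LC_iff hs).mp hbb.2
        rw [h] at h1; exact hnn (h1.symm.trans h2)
      have hv : cross3 bb.1 bb.2 ≠ 0 := cross3_ne_zero_of_ne hp1 hp2 hne hell1 hell2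
      have h1 : 1 ≤ hcf3 (cross3 bb.1 bb.2) := one_le_hcf3 hv
      have hHv : hcf3 (cross3 bb.1 bb.2) ≤ H := hcf3_cross3_le hT hB1 hB2 hv
      rw [indicator_cond_eq_sum h1 hHv (fun D : ℕ => Δ₀ < (D : ℝ) ∧ tIdx N D ∈ TI X η V T N Δ₀ n n'), ← h𝒟,
        mul_sum]
      refine sum_congr rfl fun D hD => ?_
      rw [h𝒟, mem_filter, mem_Icc] at hD
      rw [moebius_hcf_indicator hv hD.1.1 hHv, mul_sum]
      refine sum_congr rfl fun d _ => ?_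
      split_ifs <;> ring
  rw [sum_congr rfl hpt, Finset.sum_comm]
  refine sum_congr rfl fun D _ => ?_
  rw [Finset.sum_comm]
  refine sum_congr rfl fun d _ => ?_
  rw [PhiSum, ← mul_sum, sum_product]

/-! ### The main part -/

/-- `F'` is supported on primitive vectors. [folklore] -/
theorem prim_of_Fprim_ne_zero {v : ℤ × ℤ × ℤ} (h : Fprim X τ m v ≠ 0) : IsPrimitiveVec v := by
  by_contra hp; exact h (by rw [Fprim, if_neg hp])

/-- **`|Φ(e)| ≤ (T₁(e) + T₂(e))/(2e²)`** (characters and Cauchy). [cite: HeathBrownActa2001, §13 p. 78] -/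
theorem abs_PhiSum_le {e : ℕ} (he : 0 < e) (n n' : ℤ × ℤ × ℤ) :
    |PhiSum X τ m T N n n' e| ≤
      (Tsum (Fprim X τ m) (LC (T / N) n) e + Tsum (Fprim X τ m) (LC (T / N) n') e) / (2 * (e : ℝ) ^ 2) := by
  classical
  rw [PhiSum]
  exact abs_sum_dvd_cross3_le he _ _ (fun v hv => prim_of_Fprim_ne_zero hv) (fun v hv => prim_of_Fprim_ne_zero hv) _ _

/-- The `D` of a Class I cell satisfy `D ≤ ⌊810V/X⌋₊` (`X ≤ 270V`): from `⌊N log D⌋ ≤ ⌊N log(270V/X)⌋`.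
[cite: HeathBrownActa2001, §12 (12.1)] -/
theorem le_Dmax_of_tIdx_mem_Trange (hX : 0 < X) (hVX : X ≤ 270 * V) {N : ℕ} (hN : 0 < N) {Δ₀ : ℝ}
    {D : ℕ} (hD : 1 ≤ D) (ht : tIdx N D ∈ Trange N Δ₀ (270 * V / X)) : D ≤ ⌊810 * V / X⌋₊ := by
  have hNR : (0 : ℝ) < N := by exact_mod_cast hN
  set M : ℝ := 270 * V / X with hM
  have hM1 : 1 ≤ M := by rw [hM, le_div_iff₀ hX]; linarith
  have hM0 : 0 < M := by linarith
  have hlogM : 0 ≤ Real.log M := Real.log_nonneg hM1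
  rw [Trange, mem_Icc, tIdx] at ht
  obtain ⟨-, h2⟩ := ht
  have hDR : (1 : ℝ) ≤ D := by exact_mod_cast hD
  -- `N log D < ⌊N log M⌋₊ + 1 ≤ N log M + 1`
  have h3 : (N : ℝ) * Real.log D < (N : ℝ) * Real.log M + 1 := by
    have a := Nat.lt_floor_add_one ((N : ℝ) * Real.log D)
    have b : ((⌊(N : ℝ) * Real.log M⌋₊ : ℕ) : ℝ) ≤ (N : ℝ) * Real.log M := Nat.floor_le (by positivity)
    have c : ((⌊(N : ℝ) * Real.log D⌋₊ : ℕ) : ℝ) ≤ ((⌊(N : ℝ) * Real.log M⌋₊ : ℕ) : ℝ) := by exact_mod_cast h2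
    linarith
  have h4 : Real.log D < Real.log M + 1 := by
    have hN1 : (1 : ℝ) ≤ N := by exact_mod_cast hN
    by_contra hcon
    push Not at hcon
    have : (N : ℝ) * (Real.log M + 1) ≤ (N : ℝ) * Real.log D := mul_le_mul_of_nonneg_left hcon hNR.le
    nlinarith
  have h5 : (D : ℝ) < 3 * M := by
    have e3 : Real.exp 1 < 3 := by
      have := Real.exp_one_lt_d9; linarith
    have : Real.log D < Real.log (3 * M) := by
      rw [Real.log_mul (by norm_num) hM0.ne']
      have : (1 : ℝ) < Real.log 3 := by
        rw [← Real.exp_lt_exp, Real.exp_log (by norm_num)]; exact e3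
      linarith
    exact (Real.log_lt_log_iff (by linarith) (by positivity)).mp this
  apply Nat.le_floor
  rw [hM] at h5
  have : (3 : ℝ) * (270 * V / X) = 810 * V / X := by ring
  linarith

open scoped Classical in
/-- **The main part**: `|∑_{D ∈ 𝒟} ∑_{d ≤ min(H, d₀/D)} μ(d)Φ(dD)| ≤ ½ ∑_{q ≤ d₀} w(q)(U*₁(q) + U*₂(q))`.
[cite: HeathBrownActa2001, §13 (13.2)] -/
theorem abs_mainPart_le (hX : 0 < X) (hVX : X ≤ 270 * V) (hN : 0 < N) {d₀ : ℝ} (hd₀ : 0 ≤ d₀) {H : ℕ}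
    (n n' : ℤ × ℤ × ℤ) :
    |∑ D ∈ (Icc 1 H).filter (fun D : ℕ => Δ₀ < (D : ℝ) ∧ tIdx N D ∈ TI X η V T N Δ₀ n n'),
        ∑ d ∈ (Icc 1 H).filter (fun d : ℕ => d ≤ ⌊d₀ / D⌋₊), (μ d : ℝ) * PhiSum X τ m T N n n' (d * D)| ≤
      (∑ q ∈ Icc 1 ⌊d₀⌋₊, wt Δ₀ ⌊810 * V / X⌋₊ d₀ q * Ustar (Fprim X τ m) (LC (T / N) n) q +
        ∑ q ∈ Icc 1 ⌊d₀⌋₊, wt Δ₀ ⌊810 * V / X⌋₊ d₀ q * Ustar (Fprim X τ m) (LC (T / N) n') q) / 2 := by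
  classical
  set F := Fprim X τ m with hF
  set C₁ := LC (T / N) n with hC₁
  set C₂ := LC (T / N) n' with hC₂
  set 𝒟 := (Icc 1 H).filter (fun D : ℕ => Δ₀ < (D : ℝ) ∧ tIdx N D ∈ TI X η V T N Δ₀ n n') with h𝒟
  set SD := (Icc 1 ⌊810 * V / X⌋₊).filter (fun D : ℕ => Δ₀ < (D : ℝ)) with hSD
  have hsub : 𝒟 ⊆ SD := by
    intro D hD
    rw [h𝒟, mem_filter, mem_Icc] at hD
    obtain ⟨⟨hD1, -⟩, hΔD, ht⟩ := hD
    rw [hSD, mem_filter, mem_Icc]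
    refine ⟨⟨hD1, ?_⟩, hΔD⟩
    rw [TI, mem_filter] at ht
    exact le_Dmax_of_tIdx_mem_Trange hX hVX hN hD1 ht.1
  -- termwise bound
  have hterm : ∀ D ∈ 𝒟, ∀ d : ℕ, 1 ≤ d →
      |(μ d : ℝ) * PhiSum X τ m T N n n' (d * D)| ≤
        (((d * D : ℕ) : ℝ) ^ 2)⁻¹ * Tsum F C₁ (d * D) / 2 + (((d * D : ℕ) : ℝ) ^ 2)⁻¹ * Tsum F C₂ (d * D) / 2 := by
    intro D hD d hd
    rw [h𝒟, mem_filter, mem_Icc] at hD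
    have hdD : 0 < d * D := Nat.mul_pos (by omega) (by omega)
    have hμ : |(μ d : ℝ)| ≤ 1 := by exact_mod_cast ArithmeticFunction.abs_moebius_le_one
    have hΦ := abs_PhiSum_le (X := X) (τ := τ) (m := m) (T := T) (N := N) hdD n n'
    rw [abs_mul]
    calc |(μ d : ℝ)| * |PhiSum X τ m T N n n' (d * D)| ≤ 1 * |PhiSum X τ m T N n n' (d * D)| := by
          gcongr
      _ ≤ (Tsum F C₁ (d * D) + Tsum F C₂ (d * D)) / (2 * (((d * D : ℕ)) : ℝ) ^ 2) := by rw [one_mul]; exact hΦ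
      _ = _ := by
          have : (0 : ℝ) < ((d * D : ℕ) : ℝ) := by exact_mod_cast hdD
          field_simp
  calc |∑ D ∈ 𝒟, ∑ d ∈ (Icc 1 H).filter (fun d : ℕ => d ≤ ⌊d₀ / D⌋₊), (μ d : ℝ) * PhiSum X τ m T N n n' (d * D)|
      ≤ ∑ D ∈ 𝒟, |∑ d ∈ (Icc 1 H).filter (fun d : ℕ => d ≤ ⌊d₀ / D⌋₊), (μ d : ℝ) * PhiSum X τ m T N n n' (d * D)| :=
        abs_sum_le_sum_abs _ _
    _ ≤ ∑ D ∈ 𝒟, ∑ d ∈ (Icc 1 H).filter (fun d : ℕ => d ≤ ⌊d₀ / D⌋₊), |(μ d : ℝ) * PhiSum X τ m T N n n' (d * D)| :=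
        sum_le_sum fun D _ => abs_sum_le_sum_abs _ _
    _ ≤ ∑ D ∈ 𝒟, ∑ d ∈ Icc 1 ⌊d₀ / D⌋₊, |(μ d : ℝ) * PhiSum X τ m T N n n' (d * D)| := by
        refine sum_le_sum fun D _ => sum_le_sum_of_subset_of_nonneg (fun d hd => ?_) (fun _ _ _ => abs_nonneg _)
        rw [mem_filter, mem_Icc] at hd; rw [mem_Icc]; exact ⟨hd.1.1, hd.2⟩
    _ ≤ ∑ D ∈ 𝒟, ∑ d ∈ Icc 1 ⌊d₀ / D⌋₊,
          ((((d * D : ℕ) : ℝ) ^ 2)⁻¹ * Tsum F C₁ (d * D) / 2 + (((d * D : ℕ) : ℝ) ^ 2)⁻¹ * Tsum F C₂ (d * D) / 2) := by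
        refine sum_le_sum fun D hD => sum_le_sum fun d hd => ?_
        rw [mem_Icc] at hd
        exact hterm D hD d hd.1
    _ ≤ ∑ D ∈ SD, ∑ d ∈ Icc 1 ⌊d₀ / D⌋₊,
          ((((d * D : ℕ) : ℝ) ^ 2)⁻¹ * Tsum F C₁ (d * D) / 2 + (((d * D : ℕ) : ℝ) ^ 2)⁻¹ * Tsum F C₂ (d * D) / 2) := by
        refine sum_le_sum_of_subset_of_nonneg hsub fun D _ _ => sum_nonneg fun d _ => ?_
        have := Tsum_nonneg F C₁ (d * D); have := Tsum_nonneg F C₂ (d * D)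
        positivity
    _ = (∑ D ∈ SD, ∑ d ∈ Icc 1 ⌊d₀ / D⌋₊, (((d * D : ℕ) : ℝ) ^ 2)⁻¹ * Tsum F C₁ (d * D) +
          ∑ D ∈ SD, ∑ d ∈ Icc 1 ⌊d₀ / D⌋₊, (((d * D : ℕ) : ℝ) ^ 2)⁻¹ * Tsum F C₂ (d * D)) / 2 := by
        rw [← sum_add_distrib, sum_div]
        refine sum_congr rfl fun D _ => ?_
        rw [← sum_add_distrib, sum_div]
        refine sum_congr rfl fun d _ => ?_
        ring
    _ ≤ _ := by
        gcongr
        · exact sum_pairs_Tsum_le hd₀ _ F C₁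
        · exact sum_pairs_Tsum_le hd₀ _ F C₂

/-! ### The tail part -/

open scoped Classical in
/-- The count of `(D, d)` with `dD ∣ v`, `dD > d₀` is at most `σ₀(h)²`, and zero unless `h > d₀`
(`h = h.c.f.(v) ≥ 1`). [cite: HeathBrownActa2001, §12 p. 75] -/
theorem count_pairs_le {v : ℤ × ℤ × ℤ} (hv : v ≠ 0) (𝒟 : Finset ℕ) (H : ℕ) {d₀ : ℝ} (hd₀ : 0 ≤ d₀) :
    (∑ D ∈ 𝒟, ∑ d ∈ (Icc 1 H).filter (fun d : ℕ => ¬d ≤ ⌊d₀ / D⌋₊),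
        (if DvdVec ((d * D : ℕ) : ℤ) v then (1 : ℝ) else 0)) ≤
      if d₀ < (hcf3 v : ℝ) then ((σ 0 (hcf3 v) : ℝ)) ^ 2 else 0 := by
  classical
  set h := hcf3 v with hh
  have h1 : 1 ≤ h := one_le_hcf3 hv
  have h0 : h ≠ 0 := by omega
  -- the set of contributing pairs
  set P := (𝒟 ×ˢ (Icc 1 H)).filter (fun p : ℕ × ℕ => ¬p.2 ≤ ⌊d₀ / p.1⌋₊ ∧ DvdVec ((p.2 * p.1 : ℕ) : ℤ) v) with hP
  have hsum : (∑ D ∈ 𝒟, ∑ d ∈ (Icc 1 H).filter (fun d : ℕ => ¬d ≤ ⌊d₀ / D⌋₊),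
      (if DvdVec ((d * D : ℕ) : ℤ) v then (1 : ℝ) else 0)) = #P := by
    rw [hP, card_filter, Nat.cast_sum, sum_product]
    refine sum_congr rfl fun D _ => ?_
    rw [sum_filter]
    push_cast
    refine sum_congr rfl fun d _ => ?_
    by_cases h1' : d ≤ ⌊d₀ / D⌋₊
    · simp [h1']
    · simp [h1']
  rw [hsum]
  -- facts for `p ∈ P`
  have hPfacts : ∀ p ∈ P, p.2 * p.1 ∣ h ∧ d₀ < ((p.2 * p.1 : ℕ) : ℝ) := by
    intro p hp
    rw [hP, mem_filter, mem_product, mem_Icc] at hp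
    obtain ⟨⟨-, hd1, -⟩, hnot, hdvd⟩ := hp
    refine ⟨(natCast_dvd_hcf3_iff _ _).mpr hdvd, ?_⟩
    have hlt : ⌊d₀ / p.1⌋₊ < p.2 := by omega
    have hlt' : d₀ / p.1 < p.2 := (Nat.floor_lt (by positivity)).mp hlt
    rcases Nat.eq_zero_or_pos p.1 with hD0 | hD0
    · -- `D = 0`: then `dD = 0 ∣ h` forces `h = 0`, contradiction handled below via dvd
      exfalso
      have : p.2 * p.1 ∣ h := (natCast_dvd_hcf3_iff _ _).mpr hdvd
      rw [hD0, mul_zero, zero_dvd_iff] at this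
      exact h0 this
    · have hDR : (0 : ℝ) < p.1 := by exact_mod_cast hD0
      rw [div_lt_iff₀ hDR] at hlt'
      push_cast; linarith
  by_cases hcase : d₀ < (h : ℝ)
  · rw [if_pos hcase]
    -- inject into `divisors × divisors`
    have hsub : P ⊆ h.divisors ×ˢ h.divisors := by
      intro p hp
      obtain ⟨hdvd, -⟩ := hPfacts p hp
      rw [mem_product, Nat.mem_divisors, Nat.mem_divisors]
      exact ⟨⟨(Nat.dvd_mul_left p.1 p.2).trans hdvd, h0⟩, ⟨(Nat.dvd_mul_right p.2 p.1).trans hdvd, h0⟩⟩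
    calc (#P : ℝ) ≤ #(h.divisors ×ˢ h.divisors) := by exact_mod_cast card_le_card hsub
      _ = ((σ 0 h : ℕ) : ℝ) ^ 2 := by rw [card_product, ArithmeticFunction.sigma_zero_apply]; push_cast; ring
  · rw [if_neg hcase]
    have hPe : P = ∅ := by
      rw [eq_empty_iff_forall_notMem]
      intro p hp
      obtain ⟨hdvd, hgt⟩ := hPfacts p hp
      have hle : p.2 * p.1 ≤ h := Nat.le_of_dvd (by omega) hdvd
      have : ((p.2 * p.1 : ℕ) : ℝ) ≤ h := by exact_mod_cast hle
      exact hcase (lt_of_lt_of_le hgt this)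
    rw [hPe, card_empty, Nat.cast_zero]

/-- `|F'_β| ≤ 9 τ(β)`. [cite: HeathBrownActa2001, §12 p. 75] -/
theorem abs_Fprim_le (hX : 1 < X) (hτ : 0 < τ) (hτ1 : τ ≤ 1) {nn : ℕ} {m : Fin (nn + 1) → ℕ}
    (hm : CoreAdmissible τ m) (v : ℤ × ℤ × ℤ) : |Fprim X τ m v| ≤ 9 * tauK v := by
  rw [Fprim, tauK]
  split_ifs
  · exact abs_fWeight_le hX hτ hτ1 hm _
  · rw [abs_zero]; positivity

open scoped Classical in
/-- **The tail part**: `|∑_{D ∈ 𝒟} ∑_{d > d₀/D} μ(d)Φ(dD)| ≤ 81 · tailPair` (good, distinct hypercubes).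
[cite: HeathBrownActa2001, §12 pp. 75–76] -/
theorem abs_tailPart_le (hX : 1 < X) (hτ : 0 < τ) (hτ1 : τ ≤ 1) {nn : ℕ} {m : Fin (nn + 1) → ℕ}
    (hm : CoreAdmissible τ m) (hT : 0 < T) (hTV : T ^ 3 = V) (hN : 0 < N) {d₀ : ℝ} (hd₀ : 0 ≤ d₀)
    {n n' : ℤ × ℤ × ℤ} (hg : goodCube V T N n) (hg' : goodCube V T N n') (hnn : n ≠ n') (𝒟 : Finset ℕ) (H : ℕ) :
    |∑ D ∈ 𝒟, ∑ d ∈ (Icc 1 H).filter (fun d : ℕ => ¬d ≤ ⌊d₀ / D⌋₊), (μ d : ℝ) * PhiSum X τ m T N n n' (d * D)| ≤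
      81 * tailPair T N d₀ n n' := by
  classical
  have hNR : (0 : ℝ) < N := by exact_mod_cast hN
  have hs : 0 < T / N := by positivity
  set C₁ := LC (T / N) n with hC₁
  set C₂ := LC (T / N) n' with hC₂
  set F := Fprim X τ m with hF
  -- the nonnegative majorant `G(D, d, bb) = |F'F'| [dD ∣ v]`
  set G : ℕ → ℕ → (ℤ × ℤ × ℤ) × (ℤ × ℤ × ℤ) → ℝ := fun D d bb =>
    |F bb.1 * F bb.2| * (if DvdVec ((d * D : ℕ) : ℤ) (cross3 bb.1 bb.2) then (1 : ℝ) else 0) with hG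
  -- Step 1
  have step1 : |∑ D ∈ 𝒟, ∑ d ∈ (Icc 1 H).filter (fun d : ℕ => ¬d ≤ ⌊d₀ / D⌋₊), (μ d : ℝ) * PhiSum X τ m T N n n' (d * D)| ≤
      ∑ D ∈ 𝒟, ∑ d ∈ (Icc 1 H).filter (fun d : ℕ => ¬d ≤ ⌊d₀ / D⌋₊), ∑ bb ∈ C₁ ×ˢ C₂, G D d bb := by
    refine (abs_sum_le_sum_abs _ _).trans (sum_le_sum fun D _ => ?_)
    refine (abs_sum_le_sum_abs _ _).trans (sum_le_sum fun d _ => ?_)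
    have hμ : |(μ d : ℝ)| ≤ 1 := by exact_mod_cast ArithmeticFunction.abs_moebius_le_one
    rw [abs_mul, PhiSum, ← sum_product']
    calc |(μ d : ℝ)| * |∑ x ∈ C₁ ×ˢ C₂, (if DvdVec ((d * D : ℕ) : ℤ) (cross3 x.1 x.2) then F x.1 * F x.2 else 0)|
        ≤ 1 * ∑ x ∈ C₁ ×ˢ C₂, |(if DvdVec ((d * D : ℕ) : ℤ) (cross3 x.1 x.2) then F x.1 * F x.2 else 0)| :=
          mul_le_mul hμ (abs_sum_le_sum_abs _ _) (abs_nonneg _) zero_le_one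
      _ = ∑ bb ∈ C₁ ×ˢ C₂, G D d bb := by
          rw [one_mul]
          refine sum_congr rfl fun bb _ => ?_
          simp only [hG]
          split_ifs <;> simp
  -- Step 2: exchange
  have step2 : ∑ D ∈ 𝒟, ∑ d ∈ (Icc 1 H).filter (fun d : ℕ => ¬d ≤ ⌊d₀ / D⌋₊), ∑ bb ∈ C₁ ×ˢ C₂, G D d bb =
      ∑ bb ∈ C₁ ×ˢ C₂, |F bb.1 * F bb.2| *
        ∑ D ∈ 𝒟, ∑ d ∈ (Icc 1 H).filter (fun d : ℕ => ¬d ≤ ⌊d₀ / D⌋₊),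
          (if DvdVec ((d * D : ℕ) : ℤ) (cross3 bb.1 bb.2) then (1 : ℝ) else 0) := by
    calc ∑ D ∈ 𝒟, ∑ d ∈ (Icc 1 H).filter (fun d : ℕ => ¬d ≤ ⌊d₀ / D⌋₊), ∑ bb ∈ C₁ ×ˢ C₂, G D d bb
        = ∑ D ∈ 𝒟, ∑ bb ∈ C₁ ×ˢ C₂, ∑ d ∈ (Icc 1 H).filter (fun d : ℕ => ¬d ≤ ⌊d₀ / D⌋₊), G D d bb :=
          sum_congr rfl fun D _ => Finset.sum_comm
      _ = ∑ bb ∈ C₁ ×ˢ C₂, ∑ D ∈ 𝒟, ∑ d ∈ (Icc 1 H).filter (fun d : ℕ => ¬d ≤ ⌊d₀ / D⌋₊), G D d bb :=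
          Finset.sum_comm
      _ = _ := by
          refine sum_congr rfl fun bb _ => ?_
          rw [mul_sum]
          refine sum_congr rfl fun D _ => ?_
          rw [mul_sum]
  -- Step 3: pointwise
  have step3 : ∀ bb ∈ C₁ ×ˢ C₂,
      |F bb.1 * F bb.2| * ∑ D ∈ 𝒟, ∑ d ∈ (Icc 1 H).filter (fun d : ℕ => ¬d ≤ ⌊d₀ / D⌋₊),
          (if DvdVec ((d * D : ℕ) : ℤ) (cross3 bb.1 bb.2) then (1 : ℝ) else 0) ≤
        if IsPrimitiveVec bb.1 ∧ IsPrimitiveVec bb.2 ∧ cross3 bb.1 bb.2 ≠ 0 ∧ d₀ < (hcf3 (cross3 bb.1 bb.2) : ℝ)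
          then 81 * (tauK bb.1 * tauK bb.2 * ((σ 0 (hcf3 (cross3 bb.1 bb.2)) : ℝ)) ^ 2) else 0 := by
    intro bb hbb
    have hRHS0 : (0 : ℝ) ≤ if IsPrimitiveVec bb.1 ∧ IsPrimitiveVec bb.2 ∧ cross3 bb.1 bb.2 ≠ 0 ∧
        d₀ < (hcf3 (cross3 bb.1 bb.2) : ℝ) then 81 * (tauK bb.1 * tauK bb.2 * ((σ 0 (hcf3 (cross3 bb.1 bb.2)) : ℝ)) ^ 2) else 0 := by
      split_ifs
      · have := tauK_nonneg bb.1; have := tauK_nonneg bb.2; positivity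
      · exact le_rfl
    by_cases hz : F bb.1 * F bb.2 = 0
    · rw [hz, abs_zero, zero_mul]; exact hRHS0
    have hp1 : IsPrimitiveVec bb.1 := prim_of_Fprim_ne_zero (left_ne_zero_of_mul hz)
    have hp2 : IsPrimitiveVec bb.2 := prim_of_Fprim_ne_zero (right_ne_zero_of_mul hz)
    rw [mem_product] at hbb
    obtain ⟨-, -, -, -, hell1, -⟩ := good_point_facts hT hTV hN hg hbb.1
    obtain ⟨-, -, -, -, hell2, -⟩ := good_point_facts hT hTV hN hg' hbb.2
    have hne : bb.1 ≠ bb.2 := by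
      intro h
      have h1 := (mem_LC_iff hs).mp hbb.1
      have h2 := (mem_LC_iff hs).mp hbb.2
      rw [h] at h1; exact hnn (h1.symm.trans h2)
    have hv : cross3 bb.1 bb.2 ≠ 0 := cross3_ne_zero_of_ne hp1 hp2 hne hell1 hell2
    have hcnt := count_pairs_le hv 𝒟 H hd₀
    have hFF : |F bb.1 * F bb.2| ≤ 81 * (tauK bb.1 * tauK bb.2) := by
      rw [abs_mul]
      have h1 := abs_Fprim_le hX hτ hτ1 hm bb.1
      have h2 := abs_Fprim_le hX hτ hτ1 hm bb.2
      calc |F bb.1| * |F bb.2| ≤ (9 * tauK bb.1) * (9 * tauK bb.2) :=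
            mul_le_mul h1 h2 (abs_nonneg _) (by have := tauK_nonneg bb.1; positivity)
        _ = 81 * (tauK bb.1 * tauK bb.2) := by ring
    by_cases hcase : d₀ < (hcf3 (cross3 bb.1 bb.2) : ℝ)
    · rw [if_pos hcase] at hcnt
      rw [if_pos ⟨hp1, hp2, hv, hcase⟩]
      have hS0 : 0 ≤ ∑ D ∈ 𝒟, ∑ d ∈ (Icc 1 H).filter (fun d : ℕ => ¬d ≤ ⌊d₀ / D⌋₊),
          (if DvdVec ((d * D : ℕ) : ℤ) (cross3 bb.1 bb.2) then (1 : ℝ) else 0) :=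
        sum_nonneg fun D _ => sum_nonneg fun d _ => by positivity
      have ht0 : 0 ≤ 81 * (tauK bb.1 * tauK bb.2) := by
        have := tauK_nonneg bb.1; have := tauK_nonneg bb.2; positivity
      calc _ ≤ (81 * (tauK bb.1 * tauK bb.2)) * ((σ 0 (hcf3 (cross3 bb.1 bb.2)) : ℝ)) ^ 2 :=
            mul_le_mul hFF hcnt hS0 ht0
        _ = _ := by ring
    · rw [if_neg hcase] at hcnt
      rw [if_neg (fun h => hcase h.2.2.2)]
      have h0 : ∑ D ∈ 𝒟, ∑ d ∈ (Icc 1 H).filter (fun d : ℕ => ¬d ≤ ⌊d₀ / D⌋₊),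
          (if DvdVec ((d * D : ℕ) : ℤ) (cross3 bb.1 bb.2) then (1 : ℝ) else 0) = 0 :=
        le_antisymm hcnt (sum_nonneg fun D _ => sum_nonneg fun d _ => by positivity)
      rw [h0, mul_zero]
  -- Step 4
  refine step1.trans ?_
  rw [step2]
  refine (sum_le_sum step3).trans (le_of_eq ?_)
  rw [← sum_filter, tailPair, mul_sum]

/-! ### The bound for one pair of hypercubes -/

/-- `w(q) ≥ 0`. [folklore] -/
theorem wt_nonneg (Δ₀ : ℝ) (Dmax : ℕ) (d₀ : ℝ) (q : ℕ) : 0 ≤ wt Δ₀ Dmax d₀ q :=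
  sum_nonneg fun _ _ => sum_nonneg fun _ _ => by positivity

/-- `tailPair ≥ 0`. [folklore] -/
theorem tailPair_nonneg (T : ℝ) (N : ℕ) (d₀ : ℝ) (n n' : ℤ × ℤ × ℤ) : 0 ≤ tailPair T N d₀ n n' :=
  sum_nonneg fun bb _ => by have := tauK_nonneg bb.1; have := tauK_nonneg bb.2; positivity

open scoped Classical in
/-- **`|∑_{t Class I} S₆(t, 𝐧, 𝐧')| ≤ ½ ∑_{q ≤ d₀} w(q)(U*(C(𝐧),q) + U*(C(𝐧'),q)) + 81·tailPair`**.
[cite: HeathBrownActa2001, §§12–13 pp. 75–78] -/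
theorem abs_classISum_le (hX : 1 < X) (hτ : 0 < τ) (hτ1 : τ ≤ 1) {nn : ℕ} {m : Fin (nn + 1) → ℕ}
    (hm : CoreAdmissible τ m) (hT : 0 < T) (hTV : T ^ 3 = V) (hN : 0 < N) (hVX : X ≤ 270 * V)
    {d₀ : ℝ} (hd₀ : 0 ≤ d₀) (n n' : ℤ × ℤ × ℤ) :
    |classISum X η τ m V T N Δ₀ n n'| ≤
      (∑ q ∈ Icc 1 ⌊d₀⌋₊, wt Δ₀ ⌊810 * V / X⌋₊ d₀ q * Ustar (Fprim X τ m) (LC (T / N) n) q +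
        ∑ q ∈ Icc 1 ⌊d₀⌋₊, wt Δ₀ ⌊810 * V / X⌋₊ d₀ q * Ustar (Fprim X τ m) (LC (T / N) n') q) / 2 +
      81 * tailPair T N d₀ n n' := by
  classical
  have hX0 : 0 < X := by linarith
  have hA0 : ∀ n₀ : ℤ × ℤ × ℤ, 0 ≤ ∑ q ∈ Icc 1 ⌊d₀⌋₊, wt Δ₀ ⌊810 * V / X⌋₊ d₀ q * Ustar (Fprim X τ m) (LC (T / N) n₀) q :=
    fun n₀ => sum_nonneg fun q _ => mul_nonneg (wt_nonneg _ _ _ _) (Ustar_nonneg _ _ _)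
  have ht0 := tailPair_nonneg T N d₀ n n'
  by_cases hTI : TI X η V T N Δ₀ n n' = ∅
  · have : classISum X η τ m V T N Δ₀ n n' = 0 := by rw [classISum, hTI, sum_empty]
    rw [this, abs_zero]
    exact add_nonneg (div_nonneg (add_nonneg (hA0 n) (hA0 n')) (by norm_num)) (mul_nonneg (by norm_num) ht0)
  obtain ⟨t, ht⟩ := nonempty_iff_ne_empty.mpr hTI
  rw [TI, mem_filter] at ht
  obtain ⟨hg, hg', hnn⟩ := goodCube_of_classI (η := η) hX0 hT hN ht.2
  rw [classISum_eq_moebius hT hTV hg hg' hnn hN]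
  set H : ℕ := ⌊18 * T ^ 2⌋₊ + 1 with hH
  set 𝒟 := (Icc 1 H).filter (fun D : ℕ => Δ₀ < (D : ℝ) ∧ tIdx N D ∈ TI X η V T N Δ₀ n n') with h𝒟
  have hsplit : ∑ D ∈ 𝒟, ∑ d ∈ Icc 1 H, (μ d : ℝ) * PhiSum X τ m T N n n' (d * D) =
      ∑ D ∈ 𝒟, ∑ d ∈ (Icc 1 H).filter (fun d : ℕ => d ≤ ⌊d₀ / D⌋₊), (μ d : ℝ) * PhiSum X τ m T N n n' (d * D) +
      ∑ D ∈ 𝒟, ∑ d ∈ (Icc 1 H).filter (fun d : ℕ => ¬d ≤ ⌊d₀ / D⌋₊), (μ d : ℝ) * PhiSum X τ m T N n n' (d * D) := by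
    rw [← sum_add_distrib]
    refine sum_congr rfl fun D _ => ?_
    rw [sum_filter_add_sum_filter_not]
  rw [hsplit]
  refine (abs_add_le _ _).trans (add_le_add ?_ ?_)
  · exact abs_mainPart_le hX0 hVX hN hd₀ n n'
  · exact abs_tailPart_le hX hτ hτ1 hm hT hTV hN hd₀ hg hg' hnn 𝒟 H

/-! ### Summing over the pairs of hypercubes -/

open scoped Classical in
/-- **The tail pairs of all good hypercube pairs inject into `TLset`**:
`∑_{(𝐧,𝐧') good²} tailPair ≤ TL(T, d₀)`. [cite: HeathBrownActa2001, §12 pp. 76–77] -/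
theorem sum_tailPair_le_TL (hT : 0 < T) (hTV : T ^ 3 = V) (hN : 0 < N) (d₀ : ℝ) :
    ∑ nn ∈ (Nrange N).filter (fun n => goodCube V T N n) ×ˢ (Nrange N).filter (fun n => goodCube V T N n),
        tailPair T N d₀ nn.1 nn.2 ≤ TL T d₀ := by
  classical
  have hNR : (0 : ℝ) < N := by exact_mod_cast hN
  have hs : 0 < T / N := by positivity
  set GN := (Nrange N).filter (fun n => goodCube V T N n) with hGN
  set A : (ℤ × ℤ × ℤ) × (ℤ × ℤ × ℤ) → Finset ((ℤ × ℤ × ℤ) × (ℤ × ℤ × ℤ)) := fun nn =>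
    (LC (T / N) nn.1 ×ˢ LC (T / N) nn.2).filter (fun bb => IsPrimitiveVec bb.1 ∧ IsPrimitiveVec bb.2 ∧
      cross3 bb.1 bb.2 ≠ 0 ∧ d₀ < (hcf3 (cross3 bb.1 bb.2) : ℝ)) with hA
  set g : (ℤ × ℤ × ℤ) × (ℤ × ℤ × ℤ) → ℝ := fun bb =>
    tauK bb.1 * tauK bb.2 * ((σ 0 (hcf3 (cross3 bb.1 bb.2)) : ℝ)) ^ 2 with hg
  have hg0 : ∀ bb, 0 ≤ g bb := fun bb => by
    have := tauK_nonneg bb.1; have := tauK_nonneg bb.2; simp only [hg]; positivity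
  have hLHS : ∑ nn ∈ GN ×ˢ GN, tailPair T N d₀ nn.1 nn.2 = ∑ x ∈ (GN ×ˢ GN).sigma A, g x.2 := by
    rw [sum_sigma]
    refine sum_congr rfl fun nn _ => ?_
    rw [tailPair]
  rw [hLHS]
  -- injectivity of `x ↦ x.2`
  have hinj : Set.InjOn (fun x : (_ : (ℤ × ℤ × ℤ) × (ℤ × ℤ × ℤ)) × ((ℤ × ℤ × ℤ) × (ℤ × ℤ × ℤ)) => x.2)
      ((GN ×ˢ GN).sigma A : Set _) := by
    intro x hx y hy hxy
    simp only [mem_coe, mem_sigma, hA, mem_filter, mem_product] at hx hy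
    simp only at hxy
    have h1 : x.1 = y.1 := by
      obtain ⟨-, ⟨hb1, hb2⟩, -⟩ := hx
      obtain ⟨-, ⟨hb1', hb2'⟩, -⟩ := hy
      rw [hxy] at hb1 hb2
      exact Prod.ext (((mem_LC_iff hs).mp hb1).symm.trans ((mem_LC_iff hs).mp hb1'))
        (((mem_LC_iff hs).mp hb2).symm.trans ((mem_LC_iff hs).mp hb2'))
    exact Sigma.ext h1 (heq_of_eq hxy)
  rw [← sum_image (f := g) hinj]
  have hsub : ((GN ×ˢ GN).sigma A).image (fun x => x.2) ⊆ TLset T d₀ := by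
    intro bb hbb
    obtain ⟨x, hx, rfl⟩ := mem_image.mp hbb
    rw [mem_sigma, hA, mem_filter, mem_product, hGN, mem_product, mem_filter, mem_filter] at hx
    obtain ⟨⟨⟨-, hg1⟩, ⟨-, hg2⟩⟩, ⟨hb1, hb2⟩, hp1, hp2, hv, hd⟩ := hx
    obtain ⟨-, -, -, hG1, -, -⟩ := good_point_facts hT hTV hN hg1 hb1
    obtain ⟨-, -, -, hG2, -, -⟩ := good_point_facts hT hTV hN hg2 hb2
    rw [TLset, mem_filter, mem_product]
    exact ⟨⟨hG1, hG2⟩, hp1, hp2, hv, hd⟩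
  calc ∑ bb ∈ ((GN ×ˢ GN).sigma A).image (fun x => x.2), g bb ≤ ∑ bb ∈ TLset T d₀, g bb :=
        sum_le_sum_of_subset_of_nonneg hsub fun bb _ _ => hg0 bb
    _ = TL T d₀ := by rw [TL]

open scoped Classical in
/-- **The Class I cells, summed over all pairs of hypercubes**:
`∑_{(𝐧,𝐧') ∈ Nrange²} |∑_{t Class I} S₆(t,𝐧,𝐧')| ≤ #Nrange · ∑_{𝐧 good} ∑_{q ≤ d₀} w(q) U*(C(𝐧), q) + 81·TL(T, d₀)`.
[cite: HeathBrownActa2001, §§12–13 pp. 75–78] -/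
theorem sum_abs_classISum_le (hX : 1 < X) (hτ : 0 < τ) (hτ1 : τ ≤ 1) {nn : ℕ} {m : Fin (nn + 1) → ℕ}
    (hm : CoreAdmissible τ m) (hT : 0 < T) (hTV : T ^ 3 = V) (hN : 0 < N) (hVX : X ≤ 270 * V)
    {d₀ : ℝ} (hd₀ : 0 ≤ d₀) :
    ∑ nn ∈ Nrange N ×ˢ Nrange N, |classISum X η τ m V T N Δ₀ nn.1 nn.2| ≤
      #(Nrange N) * ∑ n ∈ (Nrange N).filter (fun n => goodCube V T N n),
        ∑ q ∈ Icc 1 ⌊d₀⌋₊, wt Δ₀ ⌊810 * V / X⌋₊ d₀ q * Ustar (Fprim X τ m) (LC (T / N) n) q +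
      81 * TL T d₀ := by
  classical
  have hX0 : 0 < X := by linarith
  set GN := (Nrange N).filter (fun n => goodCube V T N n) with hGN
  set A : ℤ × ℤ × ℤ → ℝ := fun n =>
    ∑ q ∈ Icc 1 ⌊d₀⌋₊, wt Δ₀ ⌊810 * V / X⌋₊ d₀ q * Ustar (Fprim X τ m) (LC (T / N) n) q with hA
  have hA0 : ∀ n, 0 ≤ A n := fun n => sum_nonneg fun q _ => mul_nonneg (wt_nonneg _ _ _ _) (Ustar_nonneg _ _ _)
  -- restrict to good pairs
  have hzero : ∀ nn ∈ Nrange N ×ˢ Nrange N, nn ∉ GN ×ˢ GN → |classISum X η τ m V T N Δ₀ nn.1 nn.2| = 0 := by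
    intro nn hnn hnot
    rw [abs_eq_zero, classISum]
    by_cases hTI : TI X η V T N Δ₀ nn.1 nn.2 = ∅
    · rw [hTI, sum_empty]
    · exfalso
      obtain ⟨t, ht⟩ := nonempty_iff_ne_empty.mpr hTI
      rw [TI, mem_filter] at ht
      obtain ⟨hg, hg', -⟩ := goodCube_of_classI (η := η) hX0 hT hN ht.2
      rw [mem_product] at hnn
      exact hnot (mem_product.mpr ⟨mem_filter.mpr ⟨hnn.1, hg⟩, mem_filter.mpr ⟨hnn.2, hg'⟩⟩)
  have hsubset : GN ×ˢ GN ⊆ Nrange N ×ˢ Nrange N :=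
    product_subset_product (filter_subset _ _) (filter_subset _ _)
  rw [← sum_subset hsubset hzero]
  calc ∑ nn ∈ GN ×ˢ GN, |classISum X η τ m V T N Δ₀ nn.1 nn.2|
      ≤ ∑ nn ∈ GN ×ˢ GN, ((A nn.1 + A nn.2) / 2 + 81 * tailPair T N d₀ nn.1 nn.2) :=
        sum_le_sum fun nn _ => abs_classISum_le hX hτ hτ1 hm hT hTV hN hVX hd₀ nn.1 nn.2
    _ = (∑ nn ∈ GN ×ˢ GN, (A nn.1 + A nn.2)) / 2 + 81 * ∑ nn ∈ GN ×ˢ GN, tailPair T N d₀ nn.1 nn.2 := by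
        rw [sum_add_distrib, sum_div, mul_sum]
    _ = (#GN * ∑ n ∈ GN, A n + #GN * ∑ n ∈ GN, A n) / 2 + 81 * ∑ nn ∈ GN ×ˢ GN, tailPair T N d₀ nn.1 nn.2 := by
        congr 2
        rw [sum_add_distrib, sum_product, sum_product]
        congr 1
        · rw [sum_comm]; simp [sum_const, nsmul_eq_mul, mul_sum]
        · simp [sum_const, nsmul_eq_mul, mul_sum]
    _ = #GN * ∑ n ∈ GN, A n + 81 * ∑ nn ∈ GN ×ˢ GN, tailPair T N d₀ nn.1 nn.2 := by ring
    _ ≤ #(Nrange N) * ∑ n ∈ GN, A n + 81 * TL T d₀ := by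
        have h1 : (#GN : ℝ) ≤ #(Nrange N) := by exact_mod_cast card_le_card (filter_subset _ _)
        have h2 := sum_tailPair_le_TL (V := V) hT hTV hN d₀
        rw [← hGN] at h2
        have h3 : 0 ≤ ∑ n ∈ GN, A n := sum_nonneg fun n _ => hA0 n
        nlinarith

end Literature.NumberTheory.Sieve.CubicSieve

end
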